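import Literature.Barriers.CriticalPhenomena.LaceExpansionPcInputs
import Literature.Barriers.CriticalPhenomena.LaceExpansionKernelFourier
import Literature.Barriers.CriticalPhenomena.LaceExpansionHighDimensionProofs
import Mathlib.MeasureTheory.Integral.Gamma
import Mathlib.MeasureTheory.Integral.Pi
import Mathlib.Analysis.SpecialFunctions.Gaussian.GaussianIntegral
import HarnessLib

/-!
# Hara's `F_{n⃗}(x;t)`: the heat factor `e^{-t(1-Ĵ)}`, its Gaussian domination, and Lemma 2.3 for `m = 0`

Support file for the named facts `Hara2008_gaussianConvolution` (`LaceExpansionXSpaceAsymptotics.lean`,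
Hara 2008, Cor. 1.4) and `Hara2008_thm13` / `Hara2008_lem23` (`LaceExpansionGaussianLemma.lean`,
`LaceExpansionGaussianLemmaAssembly.lean`: Hara 2008, Thm. 1.3 and Lemma 2.3), whose chain of
reductions is `Cor. 1.4 ⇐ Thm. 1.3 ⇐ Lemmas 2.2 + 2.3`. This file and its two sequels
(`HaraGaussianLemmaTorusIBP.lean`, `HaraGaussianLemmaSmallTime.lean`) PROVE Hara's **Lemma 2.3**
(the contribution from `t < T`, §2.4) in full generality and discharge `Hara2008_lem23`.

Hara's objects (§2.4): `J_j(x) := x_j J(x)`, `J_{j,ℓ}(x) := x_j x_ℓ J(x)` (`coordMul`), and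
`F_{n⃗}(x;t) := (I_t * ∏_j^{(*)} J_j^{(*n_j)})(x) = ∫_{[-π,π]^d} e^{ikx} e^{-t{1-Ĵ(k)}} ∏_j {i∂_jĴ(k)}^{n_j} dk/(2π)^d`
((2.32)). Here `F_{n⃗}` is DEFINED by its Fourier side (`haraF`, with `haraPhi` the integrand
factor `e^{-t(1-Ĵ)} ∏_j Ĵ_j^{n_j}`, `Ĵ_j := (x_jJ)^ = i∂_jĴ`), so that no convolution powers of
signed kernels are needed; `I_t = F_{0⃗}` (`haraI_eq_haraF_zero` in the third file).

## Contents (all PROVED)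

* `coordMul`, summability of `x_jJ`, `x_jx_ℓJ` from `Σ|x|²|J| < ∞`; the coordinate reflections
  `coordReflect` and **`|Ĵ_j(k)| ≤ K₂|k_j|`** (`norm_latticeFT_coordMul_le`, Hara's (2.27)/(2.28):
  pair `x` with its reflection; `K₂ = Σ|x|²|J|`), `|Ĵ_{j,ℓ}| ≤ K₂`;
* `heatFT`, `haraPhi`, `haraF`; `|e^{-t(1-Ĵ)}| ≤ e^{-tK₀|k|²/(2d)}` under the infrared bound;
* one-dimensional Gaussian moments `∫_ℝ |u|^n e^{-au²} = a^{-(n+1)/2}Γ((n+1)/2)`;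
* **Lemma 2.3, case `m = 0`** (`exists_norm_haraF_le`): `|F_{n⃗}(x;t)| ≤ c t^{-(d+n)/2}` for all
  `t > 0` — the integrand is dominated by the product `∏_j e^{-tK₀k_j²/(2d)}(K₂|k_j|)^{n_j}`, whose
  integral over `ℝ^d` factorises (`integral_fintype_prod_volume_eq_prod`);
* the crude bound `|F_{n⃗}| ≤ ∏(πK₂)^{n_j}` (for `t < 1` at `x = 0`), `volume [-π,π]^d = (2π)^d`,
  and `exists_coord_ge` (`x ≠ 0 ⇒ ∃ l, |x_l| = ‖x‖_∞ ≥ 1`, `⟦x⟧ ≤ √d|x_l|`).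

## References

* T. Hara, *Decay of correlations in nearest-neighbor self-avoiding walk, percolation, lattice
  trees and animals*, Ann. Probab. 36 (2008) 530–593 (arXiv:math-ph/0504021): §2.1 (2.2), Lemma 2.1
  (2.27) and its proof ((2.28)–(2.29)), §2.4: (2.30) (`J_j`, `J_{j,ℓ}`), Lemma 2.3 (2.26)/(2.35)
  and its proof, case `m = 0` ((2.32)–(2.33)) and case `x = 0` ((2.34)).
-/

noncomputable section

namespace Literature.Barriers.CriticalPhenomena

open MeasureTheory Filter Finset Literature.Probability.LatticeModels Literature.Probability.Percolation
open scoped Topology BigOperators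

variable {d : ℕ}

/-! ### Coordinate-weighted kernels `J_j(x) = x_j J(x)`, `J_{j,l}(x) = x_j x_l J(x)` -/

/-- `J_j(x) := x_j J(x)` ("`J_j^{(*n)}` denotes the `n`-fold convolution of `J_j`, not `x_j` times
`J^{(*n)}`"). [cite: Hara2008, §2.4, display (2.30) (definition of J_j, J_{j,ℓ})] -/
def coordMul (j : Fin d) (J : Site d → ℝ) (x : Site d) : ℝ := ((x j : ℤ) : ℝ) * J x

/-- Unfolding `J_j(x) = x_j J(x)`. [folklore] -/
@[simp] theorem coordMul_apply (j : Fin d) (J : Site d → ℝ) (x : Site d) :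
    coordMul j J x = ((x j : ℤ) : ℝ) * J x := rfl

/-- `|x_j| |f(x)| ≤ (1 + |x|²) |f(x)|`. [folklore] -/
theorem abs_coordMul_le (j : Fin d) (J : Site d → ℝ) (x : Site d) :
    |coordMul j J x| ≤ |J x| + euclidNorm x ^ 2 * |J x| := by
  rw [coordMul_apply, abs_mul]
  have h1 : |((x j : ℤ) : ℝ)| ≤ euclidNorm x := abs_apply_le_euclidNorm x j
  have h2 : euclidNorm x ≤ 1 + euclidNorm x ^ 2 := by nlinarith [euclidNorm_nonneg x]
  have h3 : 0 ≤ |J x| := abs_nonneg _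
  nlinarith

/-- `|x_j x_l| |f(x)| ≤ |x|² |f(x)|`. [folklore] -/
theorem abs_coordMul_coordMul_le (j l : Fin d) (J : Site d → ℝ) (x : Site d) :
    |coordMul j (coordMul l J) x| ≤ euclidNorm x ^ 2 * |J x| := by
  simp only [coordMul_apply, abs_mul]
  have h1 : |((x j : ℤ) : ℝ)| ≤ euclidNorm x := abs_apply_le_euclidNorm x j
  have h2 : |((x l : ℤ) : ℝ)| ≤ euclidNorm x := abs_apply_le_euclidNorm x l
  have h3 : 0 ≤ |J x| := abs_nonneg _
  calc |((x j : ℤ) : ℝ)| * (|((x l : ℤ) : ℝ)| * |J x|) = (|((x j : ℤ) : ℝ)| * |((x l : ℤ) : ℝ)|) * |J x| := by ring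
    _ ≤ (euclidNorm x * euclidNorm x) * |J x| :=
        mul_le_mul_of_nonneg_right (mul_le_mul h1 h2 (abs_nonneg _) (euclidNorm_nonneg x)) h3
    _ = euclidNorm x ^ 2 * |J x| := by ring

/-- `Σ |x_j J(x)| < ∞` when `Σ|J| < ∞` and `Σ|x|²|J(x)| < ∞`. [folklore] -/
theorem summable_abs_coordMul {J : Site d → ℝ} (hJ : Summable fun x => |J x|)
    (h2 : Summable fun x => euclidNorm x ^ 2 * |J x|) (j : Fin d) :
    Summable fun x => |coordMul j J x| :=
  Summable.of_nonneg_of_le (fun _ => abs_nonneg _) (abs_coordMul_le j J) (hJ.add h2)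

/-- `Σ |x_j x_l J(x)| < ∞` when `Σ|x|²|J(x)| < ∞`. [folklore] -/
theorem summable_abs_coordMul_coordMul {J : Site d → ℝ} (h2 : Summable fun x => euclidNorm x ^ 2 * |J x|)
    (j l : Fin d) : Summable fun x => |coordMul j (coordMul l J) x| :=
  Summable.of_nonneg_of_le (fun _ => abs_nonneg _) (abs_coordMul_coordMul_le j l J) h2

/-! ### Reflections and the bound `|Ĵ_j(k)| ≤ K₂ |k_j|` -/

/-- The reflection `x ↦ (x₁, …, -x_j, …, x_d)` of `ℤ^d`. [folklore] -/
def coordReflect (j : Fin d) : Site d ≃ Site d where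
  toFun x := Function.update x j (-x j)
  invFun x := Function.update x j (-x j)
  left_inv x := by
    funext i
    by_cases h : i = j
    · subst h; simp
    · simp [Function.update_of_ne h]
  right_inv x := by
    funext i
    by_cases h : i = j
    · subst h; simp
    · simp [Function.update_of_ne h]

/-- The reflected coordinate. [folklore] -/
theorem coordReflect_apply_same (j : Fin d) (x : Site d) : coordReflect j x j = -x j := by
  simp [coordReflect]

/-- The other coordinates are unchanged. [folklore] -/
theorem coordReflect_apply_of_ne {j i : Fin d} (h : i ≠ j) (x : Site d) : coordReflect j x i = x i := by
  simp [coordReflect, Function.update_of_ne h]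

/-- A coordinate reflection is a signed permutation, hence preserves `ℤ^d`-symmetric functions.
[folklore] -/
theorem IsZdSymmetric.apply_coordReflect {J : Site d → ℝ} (hJ : IsZdSymmetric J) (j : Fin d) (x : Site d) :
    J (coordReflect j x) = J x := by
  have h := hJ (Equiv.refl _) (fun i => if i = j then -1 else 1) x
  have he : Site.signedPerm (Equiv.refl _) (fun i => if i = j then (-1 : ℤˣ) else 1) x = coordReflect j x := by
    funext i
    by_cases hi : i = j
    · subst hi; simp [Site.signedPerm_apply, coordReflect_apply_same]
    · simp [Site.signedPerm_apply, hi, coordReflect_apply_of_ne hi]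
  rwa [he] at h

/-- `k · (R_j x) = k·x - 2 k_j x_j`. [folklore] -/
theorem kdot_coordReflect (k : Fin d → ℝ) (j : Fin d) (x : Site d) :
    kdot k (coordReflect j x) = kdot k x - 2 * (k j * ((x j : ℤ) : ℝ)) := by
  unfold kdot
  rw [← Finset.sum_erase_add _ _ (Finset.mem_univ j), ← Finset.sum_erase_add (Finset.univ) _ (Finset.mem_univ j)]
  rw [coordReflect_apply_same]
  have h : ∑ i ∈ Finset.univ.erase j, k i * ((coordReflect j x i : ℤ) : ℝ) = ∑ i ∈ Finset.univ.erase j, k i * ((x i : ℤ) : ℝ) :=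
    Finset.sum_congr rfl fun i hi => by rw [coordReflect_apply_of_ne (Finset.ne_of_mem_erase hi)]
  rw [h]
  push_cast
  ring

/-- **`|Ĵ_j(k)| ≤ K₂ |k_j|`** with `K₂ = Σ_x |x|²|J(x)|` ("by `ℤ^d`-symmetry,
`|∂Ĵ/∂k₁| = |Σ_x x₁ sin(k₁x₁) cos(k₂x₂)⋯ J(x)| ≤ Σ_x |k₁||x₁|²|J(x)|"): pair `x` with its reflection
in the `j`-th coordinate hyperplane. [cite: Hara2008, Lemma 2.1 (2.27) and its proof] -/
theorem norm_latticeFT_coordMul_le {J : Site d → ℝ} (hJs : IsZdSymmetric J) (hJ : Summable fun x => |J x|)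
    (h2 : Summable fun x => euclidNorm x ^ 2 * |J x|) (j : Fin d) (k : Fin d → ℝ) :
    ‖latticeFT (coordMul j J) k‖ ≤ (∑' x, euclidNorm x ^ 2 * |J x|) * |k j| := by
  set F : Site d → ℂ := fun x => (coordMul j J x : ℂ) * Complex.exp (-(Complex.I * (kdot k x : ℂ))) with hF
  have hFs : Summable F := summable_latticeFT_term (summable_abs_coordMul hJ h2 j) k
  have hFs' : Summable fun x => F (coordReflect j x) := (coordReflect j).summable_iff.2 hFs
  have h0 : latticeFT (coordMul j J) k = ∑' x, F x := rfl
  rw [h0]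
  -- the reflected series
  have hrefl : ∑' x, F x = ∑' x, F (coordReflect j x) := ((coordReflect j).tsum_eq F).symm
  have hFr : ∀ x, F (coordReflect j x) =
      -((coordMul j J x : ℂ) * Complex.exp (-(Complex.I * ((kdot k x - 2 * (k j * ((x j : ℤ) : ℝ)) : ℝ) : ℂ)))) := by
    intro x
    simp only [hF, coordMul_apply, coordReflect_apply_same, hJs.apply_coordReflect j x, kdot_coordReflect]
    push_cast
    ring
  have htwo : 2 * ∑' x, F x = ∑' x, (F x + F (coordReflect j x)) := by
    rw [two_mul, Summable.tsum_add hFs hFs', ← hrefl]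
  -- termwise bound `|F x + F(R x)| ≤ 2 |k_j| x_j² |J x|`
  have hterm : ∀ x, ‖F x + F (coordReflect j x)‖ ≤ 2 * |k j| * (euclidNorm x ^ 2 * |J x|) := by
    intro x
    rw [hFr x]
    simp only [hF, coordMul_apply]
    set a : ℝ := kdot k x with ha
    set b : ℝ := 2 * (k j * ((x j : ℤ) : ℝ)) with hb
    have e1 : ((((x j : ℤ) : ℝ) * J x : ℝ) : ℂ) * Complex.exp (-(Complex.I * (a : ℂ))) +
        -(((((x j : ℤ) : ℝ) * J x : ℝ) : ℂ) * Complex.exp (-(Complex.I * ((a - b : ℝ) : ℂ)))) =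
        ((((x j : ℤ) : ℝ) * J x : ℝ) : ℂ) * Complex.exp (-(Complex.I * (a : ℂ))) * (1 - Complex.exp (Complex.I * (b : ℂ))) := by
      rw [mul_sub, mul_one, mul_assoc, ← Complex.exp_add]
      push_cast
      ring_nf
    rw [e1, norm_mul, norm_mul, Complex.norm_real, Complex.norm_exp]
    have e2 : (-(Complex.I * (a : ℂ))).re = 0 := by simp
    rw [e2, Real.exp_zero, mul_one, Real.norm_eq_abs, abs_mul]
    have h1 : ‖1 - Complex.exp (Complex.I * (b : ℂ))‖ ≤ |b| := by
      rw [norm_sub_rev]; exact (Real.norm_exp_I_mul_ofReal_sub_one_le).trans (le_of_eq (Real.norm_eq_abs b))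
    have hxj : |((x j : ℤ) : ℝ)| ≤ euclidNorm x := abs_apply_le_euclidNorm x j
    have hxj0 : 0 ≤ |((x j : ℤ) : ℝ)| := abs_nonneg _
    calc |((x j : ℤ) : ℝ)| * |J x| * ‖1 - Complex.exp (Complex.I * (b : ℂ))‖
        ≤ |((x j : ℤ) : ℝ)| * |J x| * |b| := by gcongr
      _ = 2 * |k j| * (|((x j : ℤ) : ℝ)| * |((x j : ℤ) : ℝ)| * |J x|) := by
          rw [hb, abs_mul, abs_mul, abs_two]; ring
      _ ≤ 2 * |k j| * (euclidNorm x * euclidNorm x * |J x|) := by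
          refine mul_le_mul_of_nonneg_left ?_ (by positivity)
          exact mul_le_mul_of_nonneg_right (mul_le_mul hxj hxj hxj0 (euclidNorm_nonneg x)) (abs_nonneg _)
      _ = 2 * |k j| * (euclidNorm x ^ 2 * |J x|) := by ring
  have hbound : ‖2 * ∑' x, F x‖ ≤ 2 * |k j| * ∑' x, euclidNorm x ^ 2 * |J x| := by
    rw [htwo]
    refine (norm_tsum_le_tsum_norm (hFs.add hFs').norm).trans ?_
    rw [← tsum_mul_left]
    exact Summable.tsum_le_tsum hterm (hFs.add hFs').norm (h2.mul_left _)
  rw [norm_mul, Complex.norm_two] at hbound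
  nlinarith [norm_nonneg (∑' x, F x)]

/-- `|Ĵ_{j,l}(k)| ≤ K₂` (`Σ_x |x_j x_l| |J(x)| ≤ Σ_x |x|²|J(x)|`). [cite: Hara2008, Lemma 2.1 (2.27), second bound] -/
theorem norm_latticeFT_coordMul_coordMul_le {J : Site d → ℝ} (h2 : Summable fun x => euclidNorm x ^ 2 * |J x|)
    (j l : Fin d) (k : Fin d → ℝ) :
    ‖latticeFT (coordMul j (coordMul l J)) k‖ ≤ ∑' x, euclidNorm x ^ 2 * |J x| :=
  (norm_latticeFT_le (summable_abs_coordMul_coordMul h2 j l) k).trans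
    (Summable.tsum_le_tsum (abs_coordMul_coordMul_le j l J) (summable_abs_coordMul_coordMul h2 j l) h2)

/-! ### The heat factor `e^{-t(1-Ĵ)}`, `Φ_{n⃗,t}` and `F_{n⃗}(x;t)` -/

/-- The heat factor `e^{-t{1 - Ĵ(k)}}` of the integral representation
`1/(1-Ĵ) = ∫₀^∞ e^{-t(1-Ĵ)} dt`. [cite: Hara2008, §2.1 (2.1)–(2.2)] -/
def heatFT (J : Site d → ℝ) (t : ℝ) (k : Fin d → ℝ) : ℂ := Complex.exp (-(t : ℂ) * (1 - latticeFT J k))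

/-- `Φ_{n⃗,t}(k) := e^{-t{1-Ĵ(k)}} ∏_j Ĵ_j(k)^{n_j}`, the Fourier transform of Hara's
`F_{n⃗}(·;t) = I_t * ∏_j^{(*)} J_j^{(*n_j)}` (`Ĵ_j = i∂_jĴ` is the transform of `J_j(x) = x_j J(x)`).
[cite: Hara2008, Lemma 2.3 and (2.32)] -/
def haraPhi (J : Site d → ℝ) (t : ℝ) (n : Fin d → ℕ) (k : Fin d → ℝ) : ℂ :=
  heatFT J t k * ∏ j, latticeFT (coordMul j J) k ^ (n j)

/-- `F_{n⃗}(x;t) := ∫_{[-π,π]^d} e^{ik·x} Φ_{n⃗,t}(k) dk/(2π)^d` (Hara's `(I_t * ∏^{(*)} J_j^{(*n_j)})(x)`,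
(2.32), defined on the Fourier side). [cite: Hara2008, Lemma 2.3, (2.31)–(2.32)] -/
def haraF (J : Site d → ℝ) (t : ℝ) (n : Fin d → ℕ) (x : Site d) : ℂ :=
  (∫ k in cube d, Complex.exp (Complex.I * (kdot k x : ℂ)) * haraPhi J t n k) / ((2 * Real.pi : ℂ) ^ d)

/-- `|e^{-t(1-Ĵ(k))}| = e^{-t(1 - Re Ĵ(k))}`. [folklore] -/
theorem norm_heatFT (J : Site d → ℝ) (t : ℝ) (k : Fin d → ℝ) :
    ‖heatFT J t k‖ = Real.exp (-t * (1 - (latticeFT J k).re)) := by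
  rw [heatFT, Complex.norm_exp]
  congr 1
  simp [Complex.mul_re]

/-- Under the infrared bound `K₀|k|²/(2d) ≤ 1 - Re Ĵ(k)`, `|e^{-t(1-Ĵ(k))}| ≤ e^{-tK₀|k|²/(2d)}` for
`t ≥ 0`, `k ∈ [-π,π]^d`. [cite: Hara2008, proof of Lemma 2.2 ((2.41)) and of Lemma 2.3 ((2.33))] -/
theorem norm_heatFT_le {J : Site d → ℝ} {K₀ : ℝ}
    (hlow : ∀ k ∈ cube d, K₀ * (∑ i, k i ^ 2) / (2 * d) ≤ 1 - (latticeFT J k).re)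
    {t : ℝ} (ht : 0 ≤ t) {k : Fin d → ℝ} (hk : k ∈ cube d) :
    ‖heatFT J t k‖ ≤ Real.exp (-(t * K₀ / (2 * d)) * ∑ i, k i ^ 2) := by
  rw [norm_heatFT, Real.exp_le_exp]
  have h := hlow k hk
  have : t * (K₀ * (∑ i, k i ^ 2) / (2 * d)) ≤ t * (1 - (latticeFT J k).re) := mul_le_mul_of_nonneg_left h ht
  calc -t * (1 - (latticeFT J k).re) ≤ -(t * (K₀ * (∑ i, k i ^ 2) / (2 * d))) := by linarith
    _ = -(t * K₀ / (2 * d)) * ∑ i, k i ^ 2 := by ring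

/-- Without the infrared bound one still has `|e^{-t(1-Ĵ)}| ≤ 1` as soon as `Re Ĵ ≤ 1`, `t ≥ 0`.
[folklore] -/
theorem norm_heatFT_le_one {J : Site d → ℝ} {t : ℝ} (ht : 0 ≤ t) {k : Fin d → ℝ}
    (hk : (latticeFT J k).re ≤ 1) : ‖heatFT J t k‖ ≤ 1 := by
  rw [norm_heatFT, Real.exp_le_one_iff]
  nlinarith

/-! ### One-dimensional Gaussian moments -/

/-- `∫_ℝ |u|^n e^{-a u²} du = a^{-(n+1)/2} Γ((n+1)/2)` for `a > 0`. [folklore] -/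
theorem integral_abs_pow_mul_exp_neg_mul_sq {a : ℝ} (ha : 0 < a) (n : ℕ) :
    ∫ u : ℝ, |u| ^ n * Real.exp (-a * u ^ 2) = a ^ (-(((n : ℝ) + 1) / 2)) * Real.Gamma (((n : ℝ) + 1) / 2) := by
  have h1 : ∫ u : ℝ, |u| ^ n * Real.exp (-a * u ^ 2) = ∫ u : ℝ, (fun v => v ^ n * Real.exp (-a * v ^ 2)) |u| := by
    refine integral_congr_ae (Eventually.of_forall fun u => ?_)
    simp only [sq_abs]
  rw [h1, integral_comp_abs (f := fun v => v ^ n * Real.exp (-a * v ^ 2))]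
  have h2 : ∫ x in Set.Ioi (0 : ℝ), x ^ n * Real.exp (-a * x ^ 2) = ∫ x in Set.Ioi (0 : ℝ), x ^ (n : ℝ) * Real.exp (-a * x ^ (2 : ℝ)) :=
    setIntegral_congr_fun measurableSet_Ioi fun x _ => by rw [Real.rpow_natCast, Real.rpow_two]
  rw [h2, integral_rpow_mul_exp_neg_mul_rpow two_pos (by have := Nat.cast_nonneg (α := ℝ) n; linarith) ha]
  ring_nf

/-- `u ↦ |u|^n e^{-a u²}` is integrable for `a > 0`. [folklore] -/
theorem integrable_abs_pow_mul_exp_neg_mul_sq {a : ℝ} (ha : 0 < a) (n : ℕ) :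
    Integrable fun u : ℝ => |u| ^ n * Real.exp (-a * u ^ 2) := by
  have h := (integrable_rpow_mul_exp_neg_mul_sq ha (s := n) (by have := Nat.cast_nonneg (α := ℝ) n; linarith)).norm
  refine h.congr (Eventually.of_forall fun u => ?_)
  simp only [Real.norm_eq_abs, abs_mul, Real.rpow_natCast, abs_pow, abs_of_pos (Real.exp_pos _)]

/-- `∏_i t^{e_i} = t^{Σ e_i}` for `t > 0`. [folklore] -/
theorem prod_rpow_eq_rpow_sum {ι : Type*} (s : Finset ι) {t : ℝ} (ht : 0 < t) (e : ι → ℝ) :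
    ∏ i ∈ s, t ^ e i = t ^ ∑ i ∈ s, e i :=
  (Real.rpow_sum_of_pos ht e s).symm


/-! ### The case `m = 0` of Lemma 2.3: `|F_{n⃗}(x;t)| ≤ c t^{-(d+n)/2}` -/

/-- `‖(2π)^d‖ = (2π)^d` in `ℂ`. [folklore] -/
theorem norm_two_pi_pow (d : ℕ) : ‖((2 * Real.pi : ℂ) ^ d)‖ = (2 * Real.pi) ^ d := by
  rw [norm_pow]
  congr 1
  rw [show (2 * Real.pi : ℂ) = ((2 * Real.pi : ℝ) : ℂ) by push_cast; ring, Complex.norm_real, Real.norm_eq_abs,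
    abs_of_pos (by positivity)]

/-- Termwise bound on the cube: `|e^{ikx} Φ_{n⃗,t}(k)| ≤ ∏_j e^{-a k_j²} (K₂|k_j|)^{n_j}`, `a = tK₀/(2d)`.
[cite: Hara2008, proof of Lemma 2.3, (2.33)] -/
theorem norm_cexp_mul_haraPhi_le {J : Site d → ℝ} (hJs : IsZdSymmetric J) (hJ : Summable fun x => |J x|)
    (h2 : Summable fun x => euclidNorm x ^ 2 * |J x|) {K₀ : ℝ}
    (hlow : ∀ k ∈ cube d, K₀ * (∑ i, k i ^ 2) / (2 * d) ≤ 1 - (latticeFT J k).re)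
    {t : ℝ} (ht : 0 ≤ t) (n : Fin d → ℕ) (x : Site d) {k : Fin d → ℝ} (hk : k ∈ cube d) :
    ‖Complex.exp (Complex.I * (kdot k x : ℂ)) * haraPhi J t n k‖ ≤
      ∏ j, (Real.exp (-(t * K₀ / (2 * d)) * k j ^ 2) *
        (((∑' y, euclidNorm y ^ 2 * |J y|) * |k j|) ^ (n j))) := by
  set K := ∑' y, euclidNorm y ^ 2 * |J y| with hK
  rw [norm_mul, norm_cexp_I_mul_kdot, one_mul, haraPhi, norm_mul, norm_prod, Finset.prod_mul_distrib]
  refine mul_le_mul ?_ ?_ (Finset.prod_nonneg fun j _ => norm_nonneg _) (Finset.prod_nonneg fun j _ => (Real.exp_pos _).le)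
  · refine (norm_heatFT_le hlow ht hk).trans (le_of_eq ?_)
    rw [Finset.mul_sum, Real.exp_sum]
  · refine Finset.prod_le_prod (fun j _ => norm_nonneg _) fun j _ => ?_
    rw [norm_pow]
    exact pow_le_pow_left₀ (norm_nonneg _) (norm_latticeFT_coordMul_le hJs hJ h2 j k) _

/-- **Lemma 2.3, case `m = 0`**: `|F_{n⃗}(x;t)| ≤ c t^{-(d+n)/2}` for all `t > 0` and `x`, with
`n = Σ_j n_j` and `c` depending on `d, K₀, K₂, n⃗` ("Using bounds (1.18) and (2.27), we can bound
(2.32) as `|F_{n⃗}(x;t)| ≤ (K₂/d)^n ∫_{ℝ^d} e^{-tK₀|k|²/(2d)}|k|^n d^dk/(2π)^d = c t^{-(d+n)/2}`"; here the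
integrand is bounded by the product `∏_j e^{-tK₀k_j²/(2d)}(K₂|k_j|)^{n_j}`, whose integral factorises
into one-dimensional Gaussian moments). [cite: Hara2008, Lemma 2.3, case m = 0 ((2.32)–(2.33))] -/
theorem exists_norm_haraF_le (hd : 1 ≤ d) {J : Site d → ℝ} (hJs : IsZdSymmetric J) (hJ : Summable fun x => |J x|)
    (h2 : Summable fun x => euclidNorm x ^ 2 * |J x|) {K₀ : ℝ} (hK₀ : 0 < K₀)
    (hlow : ∀ k ∈ cube d, K₀ * (∑ i, k i ^ 2) / (2 * d) ≤ 1 - (latticeFT J k).re) (n : Fin d → ℕ) :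
    ∃ c : ℝ, 0 ≤ c ∧ ∀ t : ℝ, 0 < t → ∀ x : Site d,
      ‖haraF J t n x‖ ≤ c * t ^ (-(((d : ℝ) + ∑ j, (n j : ℝ)) / 2)) := by
  set K := ∑' y, euclidNorm y ^ 2 * |J y| with hK
  have hK0 : 0 ≤ K := tsum_nonneg fun y => mul_nonneg (sq_nonneg _) (abs_nonneg _)
  have hd0 : (0 : ℝ) < d := by exact_mod_cast hd
  set c₀ : ℝ := K₀ / (2 * d) with hc₀
  have hc₀0 : 0 < c₀ := by positivity
  set e : ℝ := -(((d : ℝ) + ∑ j, (n j : ℝ)) / 2) with he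
  -- the `t`-independent constant
  set CK : ℝ := ∏ j : Fin d, (K ^ (n j) * Real.Gamma (((n j : ℝ) + 1) / 2)) with hCK
  have hCK0 : 0 ≤ CK := Finset.prod_nonneg fun j _ => mul_nonneg (pow_nonneg hK0 _) (Real.Gamma_pos_of_pos (by positivity)).le
  refine ⟨CK * c₀ ^ e / (2 * Real.pi) ^ d, by positivity, fun t ht x => ?_⟩
  set a : ℝ := t * c₀ with ha
  have ha0 : 0 < a := mul_pos ht hc₀0
  have hta : t * K₀ / (2 * d) = a := by rw [ha, hc₀]; ring
  -- the dominating product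
  set φ : Fin d → ℝ → ℝ := fun j u => K ^ (n j) * (|u| ^ (n j) * Real.exp (-a * u ^ 2)) with hφ
  have hφ_int : ∀ j, Integrable (φ j) := fun j => (integrable_abs_pow_mul_exp_neg_mul_sq ha0 (n j)).const_mul _
  have hφ_nn : ∀ j u, 0 ≤ φ j u := fun j u => by positivity
  have hprod_int : Integrable (fun k : Fin d → ℝ => ∏ j, φ j (k j)) := Integrable.fintype_prod hφ_int
  have hpt : ∀ k ∈ cube d, ‖Complex.exp (Complex.I * (kdot k x : ℂ)) * haraPhi J t n k‖ ≤ ∏ j, φ j (k j) := by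
    intro k hk
    refine (norm_cexp_mul_haraPhi_le hJs hJ h2 hlow ht.le n x hk).trans (le_of_eq ?_)
    refine Finset.prod_congr rfl fun j _ => ?_
    rw [hφ, hta, mul_pow]; ring
  -- the integral over the cube is dominated by the product of one-dimensional moments
  have h1 : ‖∫ k in cube d, Complex.exp (Complex.I * (kdot k x : ℂ)) * haraPhi J t n k‖ ≤ ∏ j, ∫ u, φ j u := by
    calc _ ≤ ∫ k in cube d, ∏ j, φ j (k j) :=
          norm_integral_le_of_norm_le hprod_int.integrableOn
            ((ae_restrict_iff' (measurableSet_cube d)).2 (Eventually.of_forall hpt))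
      _ ≤ ∫ k : Fin d → ℝ, ∏ j, φ j (k j) := setIntegral_le_integral hprod_int
            (Eventually.of_forall fun k => Finset.prod_nonneg fun j _ => hφ_nn j (k j))
      _ = ∏ j, ∫ u, φ j u := integral_fintype_prod_volume_eq_prod φ
  -- evaluate the moments
  have h2' : ∏ j, ∫ u, φ j u = CK * a ^ e := by
    have hj : ∀ j, ∫ u, φ j u = (K ^ (n j) * Real.Gamma (((n j : ℝ) + 1) / 2)) * a ^ (-(((n j : ℝ) + 1) / 2)) := by
      intro j
      simp only [hφ]
      rw [integral_const_mul, integral_abs_pow_mul_exp_neg_mul_sq ha0]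
      ring
    rw [Finset.prod_congr rfl fun j _ => hj j, Finset.prod_mul_distrib, prod_rpow_eq_rpow_sum _ ha0, hCK, he]
    congr 2
    rw [Finset.sum_neg_distrib, ← Finset.sum_div, Finset.sum_add_distrib, Finset.sum_const, Finset.card_univ,
      Fintype.card_fin]
    simp
    ring
  have h3 : a ^ e = c₀ ^ e * t ^ e := by rw [ha, mul_comm, Real.mul_rpow hc₀0.le ht.le]
  -- conclude
  rw [haraF, norm_div, norm_two_pi_pow, div_le_iff₀ (by positivity)]
  calc _ ≤ ∏ j, ∫ u, φ j u := h1
    _ = CK * (c₀ ^ e * t ^ e) := by rw [h2', h3]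
    _ = CK * c₀ ^ e / (2 * Real.pi) ^ d * t ^ e * (2 * Real.pi) ^ d := by
        field_simp


/-! ### Crude bounds and the sup norm -/

/-- `volume [-π,π]^d = (2π)^d`. [folklore] -/
theorem volume_cube (d : ℕ) : volume (cube d) = ENNReal.ofReal ((2 * Real.pi) ^ d) := by
  rw [cube, volume_pi_pi]
  simp only [Real.volume_Icc, Finset.prod_const, Finset.card_univ, Fintype.card_fin]
  rw [show Real.pi - -Real.pi = 2 * Real.pi by ring, ENNReal.ofReal_pow (by positivity)]

/-- **Crude bound**: `|F_{n⃗}(x;t)| ≤ ∏_j (πK₂)^{n_j}` for `t ≥ 0` (bound `|e^{-t(1-Ĵ)}| ≤ 1` and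
`|Ĵ_j| ≤ K₂|k_j| ≤ πK₂` on the cube, whose volume is `(2π)^d`). [cite: Hara2008, proof of Lemma 2.3,
case x = 0, (2.34)] -/
theorem norm_haraF_le_crude {d : ℕ} {J : Site d → ℝ} (hJs : IsZdSymmetric J) (hJ : Summable fun y => |J y|)
    (h2 : Summable fun y => euclidNorm y ^ 2 * |J y|) {K₀ : ℝ} (hK₀ : 0 ≤ K₀)
    (hlow : ∀ k ∈ cube d, K₀ * (∑ i, k i ^ 2) / (2 * d) ≤ 1 - (latticeFT J k).re) {t : ℝ} (ht : 0 ≤ t)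
    (m : Fin d → ℕ) (x : Site d) :
    ‖haraF J t m x‖ ≤ ∏ j, (Real.pi * ∑' y, euclidNorm y ^ 2 * |J y|) ^ (m j) := by
  set K := ∑' y, euclidNorm y ^ 2 * |J y| with hK
  have hK0 : 0 ≤ K := tsum_nonneg fun y => mul_nonneg (sq_nonneg _) (abs_nonneg _)
  set C : ℝ := ∏ j, (Real.pi * K) ^ (m j) with hC
  have hC0 : 0 ≤ C := Finset.prod_nonneg fun j _ => pow_nonneg (by positivity) _
  have hpt : ∀ k ∈ cube d, ‖Complex.exp (Complex.I * (kdot k x : ℂ)) * haraPhi J t m k‖ ≤ C := by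
    intro k hk
    rw [norm_mul, norm_cexp_I_mul_kdot, one_mul, haraPhi, norm_mul, norm_prod]
    have hre : (latticeFT J k).re ≤ 1 := by
      have h := hlow k hk
      have : 0 ≤ K₀ * (∑ i, k i ^ 2) / (2 * d) := by
        apply div_nonneg (mul_nonneg hK₀ (Finset.sum_nonneg fun i _ => sq_nonneg _)); positivity
      linarith
    calc ‖heatFT J t k‖ * ∏ j, ‖latticeFT (coordMul j J) k ^ m j‖ ≤ 1 * ∏ j, (Real.pi * K) ^ (m j) := by
          refine mul_le_mul (norm_heatFT_le_one ht hre) ?_ (Finset.prod_nonneg fun j _ => norm_nonneg _) zero_le_one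
          refine Finset.prod_le_prod (fun j _ => norm_nonneg _) fun j _ => ?_
          rw [norm_pow]
          refine pow_le_pow_left₀ (norm_nonneg _) ((norm_latticeFT_coordMul_le hJs hJ h2 j k).trans ?_) _
          have hkj : |k j| ≤ Real.pi := abs_le.2 (by simpa using hk j (Set.mem_univ j))
          calc K * |k j| ≤ K * Real.pi := mul_le_mul_of_nonneg_left hkj hK0
            _ = Real.pi * K := mul_comm _ _
      _ = C := one_mul _
  have h1 : ‖∫ k in cube d, Complex.exp (Complex.I * (kdot k x : ℂ)) * haraPhi J t m k‖ ≤ C * (2 * Real.pi) ^ d := by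
    have h := norm_setIntegral_le_of_norm_le_const (by rw [volume_cube]; exact ENNReal.ofReal_lt_top) hpt
    have hvol : volume.real (cube d) = (2 * Real.pi) ^ d := by
      rw [measureReal_def, volume_cube, ENNReal.toReal_ofReal (by positivity)]
    rwa [hvol] at h
  rw [haraF, norm_div, norm_two_pi_pow, div_le_iff₀ (by positivity)]
  exact h1

/-- For `x ≠ 0` some coordinate realises the sup norm: `|x_l| = ‖x‖_∞ ≥ 1` and `⟦x⟧ ≤ √d |x_l|`.
[folklore] -/
theorem exists_coord_ge {d : ℕ} (hd : 1 ≤ d) {x : Site d} (hx : x ≠ 0) :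
    ∃ l : Fin d, 1 ≤ |((x l : ℤ) : ℝ)| ∧ jnorm x ≤ √(d : ℝ) * |((x l : ℤ) : ℝ)| := by
  have hne : (Finset.univ : Finset (Fin d)).Nonempty := by
    rcases d with _ | d'
    · omega
    · exact Finset.univ_nonempty
  obtain ⟨l, hl⟩ := Site.exists_natAbs_eq_supNorm hne x
  have hxl : |((x l : ℤ) : ℝ)| = (Site.supNorm x : ℝ) := by
    rw [← hl, Nat.cast_natAbs, Int.cast_abs]
  have h1 : 1 ≤ (Site.supNorm x : ℝ) := by
    have : Site.supNorm x ≠ 0 := fun h => hx (Site.supNorm_eq_zero_iff.1 h)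
    exact_mod_cast Nat.one_le_iff_ne_zero.2 this
  refine ⟨l, by rw [hxl]; exact h1, ?_⟩
  rw [hxl]
  have h2 : euclidNorm x ≤ √(d : ℝ) * Site.supNorm x := by
    rw [← Site.norm_eq_supNorm]; exact euclidNorm_le_sqrt_mul_norm x
  have h3 : (1 : ℝ) ≤ √(d : ℝ) := Real.one_le_sqrt.2 (by exact_mod_cast hd)
  unfold jnorm
  refine max_le h2 ?_
  nlinarith



end Literature.Barriers.CriticalPhenomena
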